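import Literature.AlgebraicGeometry.Morphisms.DevissageExactClassHeart
import Literature.AlgebraicGeometry.Morphisms.ProperCoherentCohomologyFiniteExt
import Literature.AlgebraicGeometry.Modules.PullbackPushforwardDerivedAdjunction
import Literature.AlgebraicGeometry.Modules.PushforwardLinear
import Literature.AlgebraicGeometry.Modules.ExtensionContraction
import Literature.AlgebraicGeometry.KTheory.EulerCharacteristic
import HarnessLib

/-!
# Finiteness of coherent cohomology on proper schemes over a field: reduction to the structure sheaf of
# an INTEGRAL proper scheme (Görtz–Wedhorn II, Thm. 23.17 / Cor. 23.18, proof; Hartshorne III, Lemma 2.10)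

`Morphisms/DevissageExactClassHeart` reduces the named fact
`GortzWedhorn2023_cohomology_proper_coherent_finite` (Görtz–Wedhorn II, Cor. 23.18, field case: for
`X → Spec k` proper and `𝓕` coherent, every `Hⁿ(X, 𝓕) = Hom_{D(Mod 𝒪_X)}(Q 𝒪_X[0], (Q 𝓕[0])⟦n⟧)` is
finite-dimensional) by the dévissage of Görtz–Wedhorn I, Lemma 12.63, to the single input
`H_OZ`: finiteness of all `Extⁿ_{𝒪_X}(𝒪_X, ι_*𝒪_Z)` for the integral closed subschemes `ι : Z = V(𝒥) ↪ X`
(`GortzWedhorn2023_cohomology_proper_coherent_finite_of_structureSheaf`).  This file moves that input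
from `X` to `Z` — "`Hⁱ(X, ι_*𝓕) = Hⁱ(Z, 𝓕)` for a closed immersion `ι`" (Hartshorne III, Lemma 2.10;
The Stacks Project, Tag 0G9R for affine morphisms) — ON THE CARRIER OF THE NAMED FACT and
`k`-LINEARLY, so that the whole fact follows from its special case `𝓕 = 𝒪_V`, `V` INTEGRAL:

* `pullbackUnitModuleIso ι : ι^*𝒪_X ≅ 𝒪_Z` (Mathlib's `SheafOfModules.pullbackObjUnitToUnit`, an
  isomorphism because `U ↦ ι⁻¹U` is final, tree `final_opensMap`);
* `shiftedHomUnitPushforwardLinearEquiv ι N n` — for a morphism `ι : Z → X` of `k`-schemes with AFFINE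
  underlying map and a finite locally free `𝒪_Z`-module `N`,
  `Hom_{D(Mod 𝒪_X)}(Q 𝒪_X[0], (Q (ι_*N)[0])⟦n⟧) ≃ₗ[k] Hom_{D(Mod 𝒪_Z)}(Q 𝒪_Z[0], (Q N[0])⟦n⟧)`:
  the tree's derived adjunction along an affine morphism for vector-bundle complexes
  (`Modules.shiftedHomLinearEquivPullbackPushforwardOfVectorBundles`, route K: injective resolution of
  `N[0]`, Leray `Rι_* = ι_*` for the affine `ι`, termwise adjunction; NO flatness of `ι`), at
  `M• = 𝒪_X[0]`, `E• = N[0]`, composed with `ι^*𝒪_X[0] ≅ 𝒪_Z[0]` and `ι_*(N[0]) = (ι_*N)[0]`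
  (Mathlib `HomologicalComplex.singleMapHomologicalComplex`); `k`-linear because `ι_*` is
  (`Modules/PushforwardLinear.linear_pushforward`);
* `extUnitFinite_pushforward_of_carrier` — hence `Extⁿ_{𝒪_X}(𝒪_X, ι_*N)` is finite over `k` for all `n`
  as soon as the carrier `Hom_D(Q 𝒪_Z[0], (Q N[0])⟦n⟧)` is, for all `n`;
* **`GortzWedhorn2023_cohomology_proper_coherent_finite_of_integral`** — THE NAMED FACT (all fields
  `k`, all proper `X → Spec k`, all coherent `𝓕`, all `n`) FOLLOWS FROM ITS CASE `𝓕 = 𝒪_V` ON INTEGRAL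
  PROPER `V → Spec k`: `∀ k V [IsProper V.hom] [IsIntegral V.left] n,
  Module.Finite k (Hom_{D(Mod 𝒪_V)}(Q 𝒪_V[0], (Q 𝒪_V[0])⟦n⟧))` — the closed subscheme `Z = V(𝒥)` of
  the heart step (`𝒥` radical with irreducible non-empty support) is integral
  (`Morphisms/SubschemeIntegral.isIntegral_subscheme`) and proper over `k` (closed immersion followed by
  a proper map), and `ι = 𝒥.subschemeι` is a closed immersion, hence affine;
* `GortzWedhorn2023_cohomology_proper_coherent_finite_of_integral_ext` — the same with the input in
  `Ext` form, `Module.Finite k (Extⁿ(𝒪_V, 𝒪_V))` (`extUnitLinearEquivCarrier`).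

This is exactly the shape in which the printed proof of Thm. 23.17 uses noetherian induction: assertion
(3) there ("there exists a coherent `𝒪_X`-module `𝓖` such that `Supp 𝓖 = X` and all `Rⁱf_*𝓖` are
coherent", for `X` integral, via Chow's lemma) is what remains; in the tree it is the finiteness of the
ordered Čech cohomology of the rank-one family `𝒪_V ⊆ K(V)`
(`Motives/CechCoherentDevissage.FracFamily.moduleFinite_homology_of_isCoherent` with
`Motives/CechComplexPseudoCoherentGeneralProofs.chowFamilies`), to be joined to this carrier by the
Čech–`Ext` comparison of `Modules/CechComputesCohomology` / `Modules/CechOrderedComplex`.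
Everything here is proved; no new named fact; nothing here says the named fact holds.

## References

* U. Görtz, T. Wedhorn, *Algebraic Geometry II: Cohomology of Schemes* (2023), Thm. 23.17 with its
  proof, Cor. 23.18 (pp. 424–425); Prop. 21.27 / Cor. 22.6 (cohomology and affine push-forward).
  [GortzWedhorn2023]
* U. Görtz, T. Wedhorn, *Algebraic Geometry I: Schemes*, 2nd ed. (2020), Lemma 12.63 (p. 436).
  [GortzWedhorn2020]
* R. Hartshorne, *Algebraic Geometry*, GTM 52 (1977), III Lemma 2.10 (p. 209), III Prop. 8.1,
  II §5 p. 110. [Hartshorne1977]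
* J. Lipman, *Notes on derived functors and Grothendieck duality*, LNM 1960 (2009), Prop. 3.2.3. [Lipman2009]
* The Stacks Project, Tags 0G9R, 01XC, 0DVC. [StacksProject]
-/

noncomputable section

-- `TopCat.Presheaf`/`Scheme.Modules` are not reducible (as in Mathlib's `AlgebraicGeometry/Modules/Sheaf.lean`).
set_option backward.isDefEq.respectTransparency false

open CategoryTheory CategoryTheory.Limits CategoryTheory.Abelian AlgebraicGeometry TopologicalSpace

namespace Literature.AlgebraicGeometry.Morphisms

open Literature.AlgebraicGeometry.Modules Literature.AlgebraicGeometry.Motives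
  Literature.AlgebraicGeometry.KTheory

/-! ## The transfer `Hom_D(Q 𝒪_X[0], Q (ι_*N)[0]⟦n⟧) ≃ₗ[k] Hom_D(Q 𝒪_Z[0], Q N[0]⟦n⟧)` along an affine `ι` -/

section Transfer

variable {k : Type} [CommRing k] {Z X : Over (Spec (CommRingCat.of k))} (ι : Z ⟶ X)

/-- Mathlib's comparison `ι^*𝒪_X ⟶ 𝒪_Z`, typed in `Z.Modules`. [cite: Hartshorne1977, II §5 p. 110 (f^*𝒪_Y = 𝒪_X)] -/
abbrev pullbackUnitToUnit :
    (Scheme.Modules.pullback ι.left).obj (unitModule X.left) ⟶ unitModule Z.left :=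
  SheafOfModules.pullbackObjUnitToUnit ι.left.toRingCatSheafHom

/-- `ι^*𝒪_X ⟶ 𝒪_Z` is an isomorphism (the functor `U ↦ ι⁻¹U` is final). [cite: Hartshorne1977, II §5 p. 110 (f^*𝒪_Y = 𝒪_X)] -/
theorem isIso_pullbackUnitToUnit : IsIso (pullbackUnitToUnit ι) := by
  haveI := final_opensMap ι.left
  exact (inferInstance : IsIso (SheafOfModules.pullbackObjUnitToUnit ι.left.toRingCatSheafHom))

/-- **`ι^*𝒪_X ≅ 𝒪_Z`** for a morphism of schemes `ι : Z → X`: Mathlib's comparison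
`SheafOfModules.pullbackObjUnitToUnit` is an isomorphism because the functor `U ↦ ι⁻¹U` on opens is
final (tree `KTheory/PullbackVectorBundle.final_opensMap`). [cite: Hartshorne1977, II §5 p. 110 (f^*𝒪_Y = 𝒪_X)] -/
def pullbackUnitModuleIso :
    (Scheme.Modules.pullback ι.left).obj (unitModule X.left) ≅ unitModule Z.left :=
  haveI := isIso_pullbackUnitToUnit ι
  asIso (pullbackUnitToUnit ι)

/-- `pullbackUnitModuleIso` is Mathlib's `pullbackObjUnitToUnit`. [cite: Hartshorne1977, II §5 p. 110 (f^*𝒪_Y = 𝒪_X)] -/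
theorem pullbackUnitModuleIso_hom :
    (pullbackUnitModuleIso ι).hom = pullbackUnitToUnit ι :=
  rfl

/-- `ι^*(𝒪_X[0]) ≅ 𝒪_Z[0]` as cochain complexes (`ι^*` termwise). [cite: Hartshorne1977, II §5 p. 110 (f^*𝒪_Y = 𝒪_X)] -/
def pullbackSingleUnitIso :
    ((Scheme.Modules.pullback ι.left).mapHomologicalComplex (ComplexShape.up ℤ)).obj
        ((HomologicalComplex.single X.left.Modules (ComplexShape.up ℤ) 0).obj (unitModule X.left)) ≅
      (HomologicalComplex.single Z.left.Modules (ComplexShape.up ℤ) 0).obj (unitModule Z.left) :=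
  ((HomologicalComplex.singleMapHomologicalComplex (Scheme.Modules.pullback ι.left)
      (ComplexShape.up ℤ) 0).app (unitModule X.left)).trans
    ((HomologicalComplex.single Z.left.Modules (ComplexShape.up ℤ) 0).mapIso (pullbackUnitModuleIso ι))

/-- `ι_*(N[0]) ≅ (ι_*N)[0]` as cochain complexes (`ι_*` termwise). [cite: Hartshorne1977, II §5 p. 110 (f_*)] -/
def pushforwardSingleIso (N : Z.left.Modules) :
    ((Scheme.Modules.pushforward ι.left).mapHomologicalComplex (ComplexShape.up ℤ)).obj
        ((HomologicalComplex.single Z.left.Modules (ComplexShape.up ℤ) 0).obj N) ≅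
      (HomologicalComplex.single X.left.Modules (ComplexShape.up ℤ) 0).obj
        ((Scheme.Modules.pushforward ι.left).obj N) :=
  (HomologicalComplex.singleMapHomologicalComplex (Scheme.Modules.pushforward ι.left)
    (ComplexShape.up ℤ) 0).app N

variable [IsAffineHom ι.left]

/-- **Cohomology and affine direct image, on the carrier of the named fact, `k`-linearly**: for a
morphism `ι : Z → X` of `k`-schemes with affine underlying map (e.g. a closed immersion) and a finite
locally free `𝒪_Z`-module `N`,
`Hom_{D(Mod 𝒪_X)}(Q 𝒪_X[0], (Q (ι_*N)[0])⟦n⟧) ≃ₗ[k] Hom_{D(Mod 𝒪_Z)}(Q 𝒪_Z[0], (Q N[0])⟦n⟧)`, i.e.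
`Hⁿ(X, ι_*N) ≅ Hⁿ(Z, N)`.  It is the tree's derived adjunction along an affine morphism on vector-bundle
complexes (`Modules.shiftedHomLinearEquivPullbackPushforwardOfVectorBundles`: `Rι_*N = ι_*N` by Leray for
the affine `ι`, termwise adjunction `ι^* ⊣ ι_*` on an injective resolution; no flatness) at
`M• = 𝒪_X[0]`, `E• = N[0]`, moved along `ι^*𝒪_X[0] ≅ 𝒪_Z[0]` and `ι_*(N[0]) = (ι_*N)[0]`; `ι_*` is
`k`-linear over `Spec k` (`linear_pushforward`).
[cite: Hartshorne1977, III Lemma 2.10 (p. 209) and III Prop. 8.1] [cite: GortzWedhorn2023, Cor. 22.6] [cite: Lipman2009, Prop. 3.2.3] -/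
def shiftedHomUnitPushforwardLinearEquiv (N : Z.left.Modules) (hN : IsFiniteLocallyFree N) (n : ℕ) :
    letI := HasDerivedCategory.standard X.left.Modules
    letI := HasDerivedCategory.standard Z.left.Modules
    ShiftedHom
        (DerivedCategory.Q.obj ((HomologicalComplex.single X.left.Modules (ComplexShape.up ℤ) 0).obj
          (unitModule X.left)))
        (DerivedCategory.Q.obj ((HomologicalComplex.single X.left.Modules (ComplexShape.up ℤ) 0).obj
          ((Scheme.Modules.pushforward ι.left).obj N)))
        (n : ℤ) ≃ₗ[k]
      ShiftedHom
        (DerivedCategory.Q.obj ((HomologicalComplex.single Z.left.Modules (ComplexShape.up ℤ) 0).obj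
          (unitModule Z.left)))
        (DerivedCategory.Q.obj ((HomologicalComplex.single Z.left.Modules (ComplexShape.up ℤ) 0).obj N))
        (n : ℤ) := by
  letI := HasDerivedCategory.standard X.left.Modules
  letI := HasDerivedCategory.standard Z.left.Modules
  haveI : (Scheme.Modules.pushforward ι.left).Linear k := linear_pushforward ι
  -- the bounds and vector-bundle terms of the two single complexes
  have hM := IsBoundedVBComplex.single (unitModule X.left) isFiniteLocallyFree_unitModule 0
  have hE := IsBoundedVBComplex.single N hN 0
  have hMa : ∀ p : ℤ, p < 0 → IsZero (((HomologicalComplex.single X.left.Modules (ComplexShape.up ℤ) 0).obj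
      (unitModule X.left)).X p) := fun p hp =>
    HomologicalComplex.isZero_single_obj_X (ComplexShape.up ℤ) 0 _ p (by omega)
  have hMb : ∀ p : ℤ, 1 ≤ p → IsZero (((HomologicalComplex.single X.left.Modules (ComplexShape.up ℤ) 0).obj
      (unitModule X.left)).X p) := fun p hp =>
    HomologicalComplex.isZero_single_obj_X (ComplexShape.up ℤ) 0 _ p (by omega)
  have hEa : ∀ p : ℤ, p < 0 → IsZero (((HomologicalComplex.single Z.left.Modules (ComplexShape.up ℤ) 0).obj
      N).X p) := fun p hp =>
    HomologicalComplex.isZero_single_obj_X (ComplexShape.up ℤ) 0 _ p (by omega)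
  -- the derived adjunction on `𝒪_X[0]`, `N[0]`
  let adj := shiftedHomLinearEquivPullbackPushforwardOfVectorBundles (𝕜 := k) ι.left
    ((HomologicalComplex.single X.left.Modules (ComplexShape.up ℤ) 0).obj (unitModule X.left)) 0 1 hMa hMb
    hM.isFiniteLocallyFree ((HomologicalComplex.single Z.left.Modules (ComplexShape.up ℤ) 0).obj N) 0 hEa
    hE.isFiniteLocallyFree (n : ℤ)
  -- move along `ι_*(N[0]) ≅ (ι_*N)[0]` on the target and `ι^*𝒪_X[0] ≅ 𝒪_Z[0]` on the source
  exact ((Linear.homCongr k (Iso.refl _)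
      ((shiftFunctor (DerivedCategory X.left.Modules) (n : ℤ)).mapIso
        (DerivedCategory.Q.mapIso (pushforwardSingleIso ι N)))).symm.trans adj.symm).trans
    (Linear.homCongr k (DerivedCategory.Q.mapIso (pullbackSingleUnitIso ι)) (Iso.refl _))

/-- **`Extⁿ_{𝒪_X}(𝒪_X, ι_*N)` is finite over `k` for every `n`** (`ExtUnitFinite X (ι_*N)`) as soon as
all the carriers `Hom_{D(Mod 𝒪_Z)}(Q 𝒪_Z[0], (Q N[0])⟦n⟧)` on `Z` are — `ι` with affine underlying map,
`N` finite locally free (`shiftedHomUnitPushforwardLinearEquiv` and `extUnitLinearEquivCarrier`).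
[cite: Hartshorne1977, III Lemma 2.10 (p. 209)] [cite: GortzWedhorn2023, Cor. 22.6] -/
theorem extUnitFinite_pushforward_of_carrier (N : Z.left.Modules) (hN : IsFiniteLocallyFree N)
    (h : ∀ n : ℕ,
      letI := HasDerivedCategory.standard Z.left.Modules
      Module.Finite k (ShiftedHom
        (DerivedCategory.Q.obj ((HomologicalComplex.single Z.left.Modules (ComplexShape.up ℤ) 0).obj
          (unitModule Z.left)))
        (DerivedCategory.Q.obj ((HomologicalComplex.single Z.left.Modules (ComplexShape.up ℤ) 0).obj N))
        (n : ℤ))) :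
    ExtUnitFinite.{1} X ((Scheme.Modules.pushforward ι.left).obj N) := by
  intro n
  letI := HasDerivedCategory.standard X.left.Modules
  letI := HasDerivedCategory.standard Z.left.Modules
  haveI := h n
  haveI := Module.Finite.equiv (shiftedHomUnitPushforwardLinearEquiv ι N hN n).symm
  exact Module.Finite.equiv
    (extUnitLinearEquivCarrier.{1} X ((Scheme.Modules.pushforward ι.left).obj N) n).symm

end Transfer

/-! ## The named fact from its case `𝓕 = 𝒪_V`, `V` integral -/

/-- **Görtz–Wedhorn II, Cor. 23.18 (field case) follows from its special case `𝓕 = 𝒪_V` on INTEGRAL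
proper `V → Spec k`.**  Given, for every field `k`, every proper `V → Spec k` with `V` integral and every
`n`, that `Hⁿ(V, 𝒪_V) = Hom_{D(Mod 𝒪_V)}(Q 𝒪_V[0], (Q 𝒪_V[0])⟦n⟧)` is finite-dimensional, the named fact
`GortzWedhorn2023_cohomology_proper_coherent_finite` holds (all proper `X`, all coherent `𝓕`, all `n`).
Proof: `GortzWedhorn2023_cohomology_proper_coherent_finite_of_structureSheaf` (the dévissage of
Görtz–Wedhorn I Lemma 12.63 run on the exact class `𝒦_Ext`) leaves the input
`Extⁿ_{𝒪_X}(𝒪_X, ι_*𝒪_Z)` finite for `Z = V(𝒥) ↪ X`, `𝒥` radical with irreducible non-empty support;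
such `Z` is integral (`isIntegral_subscheme`) and proper over `k`, `ι` is a closed immersion hence
affine, and `extUnitFinite_pushforward_of_carrier` (Hartshorne III 2.10 on the carrier, `k`-linearly)
moves the input to `Z`. [cite: GortzWedhorn2023, Thm. 23.17 with proof and Cor. 23.18 (pp. 424–425)] [cite: GortzWedhorn2020, Lemma 12.63 (p. 436)] [cite: Hartshorne1977, III Lemma 2.10 (p. 209)] -/
theorem GortzWedhorn2023_cohomology_proper_coherent_finite_of_integral
    (hInt : ∀ (k : Type) [Field k] (V : Over (Spec (CommRingCat.of k))) [IsProper V.hom]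
      [IsIntegral V.left] (n : ℕ),
      letI := HasDerivedCategory.standard V.left.Modules
      Module.Finite k (ShiftedHom
        (DerivedCategory.Q.obj ((HomologicalComplex.single V.left.Modules (ComplexShape.up ℤ) 0).obj
          (unitModule V.left)))
        (DerivedCategory.Q.obj ((HomologicalComplex.single V.left.Modules (ComplexShape.up ℤ) 0).obj
          (unitModule V.left)))
        (n : ℤ))) :
    GortzWedhorn2023_cohomology_proper_coherent_finite := by
  refine GortzWedhorn2023_cohomology_proper_coherent_finite_of_structureSheaf
    fun k _ X _ J hJtop hJrad hJirr => ?_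
  -- `Z = V(𝒥)` is integral
  have hne : ((J.support : Closeds X.left) : Set X.left).Nonempty := by
    rw [Set.nonempty_iff_ne_empty]
    intro h0
    exact hJtop ((Scheme.IdealSheafData.support_eq_bot_iff J).mp (Closeds.ext h0))
  haveI : IsIntegral J.subscheme := isIntegral_subscheme J hJrad ⟨hne, hJirr⟩
  -- `Z → X → Spec k` as a `k`-scheme, `ι` as a morphism of `k`-schemes
  let Z : Over (Spec (CommRingCat.of k)) := Over.mk (J.subschemeι ≫ X.hom)
  let ι : Z ⟶ X := Over.homMk J.subschemeι rfl
  haveI : IsProper Z.hom := inferInstanceAs (IsProper (J.subschemeι ≫ X.hom))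
  haveI : IsIntegral Z.left := inferInstanceAs (IsIntegral J.subscheme)
  haveI : IsAffineHom ι.left := inferInstanceAs (IsAffineHom J.subschemeι)
  exact extUnitFinite_pushforward_of_carrier ι (unitModule Z.left) isFiniteLocallyFree_unitModule
    (fun n => hInt k Z n)

/-- The same reduction with the input in `Ext` form: the named fact follows from
`Module.Finite k (Extⁿ_{𝒪_V}(𝒪_V, 𝒪_V))` for all fields `k`, all proper INTEGRAL `V → Spec k`, all `n`
(Mathlib's `Ext` of `V.Modules` in universe `1`; `extUnitLinearEquivCarrier`).
[cite: GortzWedhorn2023, Thm. 23.17 with proof and Cor. 23.18 (pp. 424–425)] [cite: Hartshorne1977, III Lemma 2.10 (p. 209)] -/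
theorem GortzWedhorn2023_cohomology_proper_coherent_finite_of_integral_ext
    (hInt : ∀ (k : Type) [Field k] (V : Over (Spec (CommRingCat.of k))) [IsProper V.hom]
      [IsIntegral V.left] (n : ℕ), Module.Finite k (Ext.{1} (unitModule V.left) (unitModule V.left) n)) :
    GortzWedhorn2023_cohomology_proper_coherent_finite := by
  refine GortzWedhorn2023_cohomology_proper_coherent_finite_of_integral fun k _ V _ _ n => ?_
  letI := HasDerivedCategory.standard V.left.Modules
  haveI := hInt k V n
  exact Module.Finite.equiv (extUnitLinearEquivCarrier.{1} V (unitModule V.left) n)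

end Literature.AlgebraicGeometry.Morphisms

end
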